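import Summits.QuantumFields.YangMills.Theorems.IR.AfPincerUcPortBoxDefs

/-!
# The box instance of the defect engine for the `af-pincer-Uc` port: geometry and kernel bookkeeping

Helper lemmas for item `stmt-QuantumFields-19354` (crux `IR`, line `af-pincer-Uc`, stub `stub_typCriterionUc`; architecture
δ' of `MEMO-g6-port-map.md`, seat ym-cruxidea-19354-1 g6).  Pure bookkeeping about the definitions of
`Theorems.IR.AfPincerUcPortBoxDefs`:

* §1 boxes: membership, `innerCells ⊆ boxCells`, labels of box cells are injective and their cyclic distance on the
  phantom-padded coarse torus is the `ℤ⁴` sup-distance `cellDist` (no wrap-around: `2 (m - 1) < 2m + 4n + 3`);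
* §2 box links: a link lies in the box iff its frame cell is a box cell; `boxCell` identifies links of the same cell;
  cell-unions of box links are the link sets `regionEdges w Y` of sets `Y` of box cells;
* §3 `boxExt` / `boxRestrict`: evaluation, `boxRestrict ∘ boxExt = id`, `boxExt ∘ boxRestrict = id` on configurations
  equal to the padding off the box, measurability, typicality of padded data on box / non-box cells, the good family
  at box labels and at phantom labels;
* §4 `boxSpec`: values on measurable sets, integrals (`integral_map`), probability.

HONEST FRAMING: bookkeeping for one stub of one open gap-crux of a CONDITIONAL chain; no claim about the crux or the gap.
-/

set_option autoImplicit false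

noncomputable section

open MeasureTheory
open Literature.MathematicalPhysics.QuantumLattice
open Literature.Probability.LatticeModels
open Summit.QuantumFields.YangMills.Cruxes.IR.Tempered (cellEdges regionEdges)
open Summit.QuantumFields.YangMills.Cruxes.IR.CellTempered.Engine (frameCell frameCell_eq_iff mem_cellEdges_frameCell)

namespace Summit.QuantumFields.YangMills.Cruxes.IR.AfPincerUc.Port

/-! ## §1 Boxes and labels -/

section Geometry

variable {x₀ : Fin 4 → ℤ} {m n : ℕ}

/-- Membership in the box of cells. -/
theorem mem_boxCells_iff (x₀ : Fin 4 → ℤ) (m : ℕ) (y : Fin 4 → ℤ) :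
    y ∈ boxCells x₀ m ↔ ∀ i, x₀ i ≤ y i ∧ y i < x₀ i + m := by
  simp [boxCells, Fintype.mem_piFinset]

/-- Membership in the inner cells. -/
theorem mem_innerCells_iff (x₀ : Fin 4 → ℤ) (m : ℕ) (y : Fin 4 → ℤ) :
    y ∈ innerCells x₀ m ↔ ∀ i, x₀ i + 1 ≤ y i ∧ y i < x₀ i + m - 1 := by
  simp [innerCells, Fintype.mem_piFinset]

/-- Inner cells are box cells. -/
theorem innerCells_subset_boxCells (x₀ : Fin 4 → ℤ) (m : ℕ) : innerCells x₀ m ⊆ boxCells x₀ m := by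
  intro y hy
  rw [mem_innerCells_iff] at hy
  rw [mem_boxCells_iff]
  intro i
  constructor <;> linarith [(hy i).1, (hy i).2]

/-- Rind cells are box cells. -/
theorem rindCells_subset_boxCells (x₀ : Fin 4 → ℤ) (m : ℕ) : rindCells x₀ m ⊆ boxCells x₀ m :=
  Finset.sdiff_subset

/-- A box cell is inner or in the rind. -/
theorem mem_innerCells_or_mem_rindCells {y : Fin 4 → ℤ} (hy : y ∈ boxCells x₀ m) :
    y ∈ innerCells x₀ m ∨ y ∈ rindCells x₀ m := by
  by_cases h : y ∈ innerCells x₀ m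
  · exact Or.inl h
  · exact Or.inr (Finset.mem_sdiff.2 ⟨hy, h⟩)

/-- `cellDist` bounds every coordinate difference. -/
theorem abs_sub_le_cellDist (x y : Fin 4 → ℤ) (i : Fin 4) : |x i - y i| ≤ cellDist x y := by
  rw [Int.abs_eq_natAbs, Int.ofNat_le]
  exact Finset.le_sup (f := fun i : Fin 4 => (x i - y i).natAbs) (Finset.mem_univ i)

/-- `cellDist ≤ D` iff every coordinate difference is `≤ D`. -/
theorem cellDist_le_iff {x y : Fin 4 → ℤ} {D : ℕ} : cellDist x y ≤ D ↔ ∀ i, |x i - y i| ≤ D := by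
  simp only [cellDist, Finset.sup_le_iff, Finset.mem_univ, forall_true_left, Int.abs_eq_natAbs, Int.ofNat_le]

/-- `cellDist` is symmetric. -/
theorem cellDist_comm (x y : Fin 4 → ℤ) : cellDist x y = cellDist y x := by
  simp only [cellDist]
  congr 1
  funext i
  rw [← Int.natAbs_neg, neg_sub]

/-- No wrap-around below half the period: `2|z| < M ⇒ valMinAbs (z mod M) = z`. -/
private theorem valMinAbs_intCast_of_two_mul_abs_lt {M : ℕ} [NeZero M] {z : ℤ} (hz : 2 * |z| < (M : ℤ)) :
    ((z : ZMod M)).valMinAbs = z := by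
  rw [ZMod.valMinAbs_spec]
  refine ⟨rfl, ?_, ?_⟩ <;> [linarith [abs_nonneg z, neg_abs_le z, le_abs_self z]; linarith [le_abs_self z]]

/-- The label difference of two box cells, read as the representative of least absolute value, is the `ℤ⁴`
coordinate difference (the padding prevents wrap-around). -/
theorem valMinAbs_boxLabel_sub {y y' : Fin 4 → ℤ} (hy : y ∈ boxCells x₀ m) (hy' : y' ∈ boxCells x₀ m) (i : Fin 4) :
    ((boxLabel x₀ m n y i - boxLabel x₀ m n y' i).valMinAbs : ℤ) = y i - y' i := by
  rw [mem_boxCells_iff] at hy hy'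
  have h1 := hy i
  have h2 := hy' i
  have hcast : boxLabel x₀ m n y i - boxLabel x₀ m n y' i = ((y i - y' i : ℤ) : ZMod (boxMod m n i + 1)) := by
    simp only [boxLabel]
    push_cast
    ring
  rw [hcast]
  refine valMinAbs_intCast_of_two_mul_abs_lt ?_
  simp only [boxMod]
  push_cast
  rcases le_or_gt 0 (y i - y' i) with h | h
  · rw [abs_of_nonneg h]; linarith
  · rw [abs_of_neg h]; linarith

/-- **The cyclic distance of two box labels is the `ℤ⁴` sup-distance of the cells.** -/
theorem cdist_boxLabel {y y' : Fin 4 → ℤ} (hy : y ∈ boxCells x₀ m) (hy' : y' ∈ boxCells x₀ m) :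
    cdist (boxLabel x₀ m n y) (boxLabel x₀ m n y') = cellDist y y' := by
  simp only [cdist, cellDist]
  congr 1
  funext i
  rw [valMinAbs_boxLabel_sub (n := n) hy hy' i]

/-- Labels are injective on box cells. -/
theorem boxLabel_injOn : Set.InjOn (boxLabel x₀ m n) ↑(boxCells x₀ m) := by
  intro y hy y' hy' h
  funext i
  have h1 := valMinAbs_boxLabel_sub (n := n) (Finset.mem_coe.1 hy) (Finset.mem_coe.1 hy') i
  rw [h, sub_self, ZMod.valMinAbs_zero] at h1
  linarith

end Geometry

/-! ## §2 Box links and their cells -/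

section Links

variable {w : Fin 4 → ℤ → ℤ} (hw : ∀ i j, w i j + 1 ≤ w i (j + 1)) {x₀ : Fin 4 → ℤ} {m n : ℕ}

include hw in
/-- Membership in a union of cells, through the cell-index map. -/
theorem mem_regionEdges_iff (Y : Finset (Fin 4 → ℤ)) (e : ZdEdge 4) :
    e ∈ regionEdges w Y ↔ frameCell w e ∈ Y := by
  simp only [Summit.QuantumFields.YangMills.Cruxes.IR.Tempered.regionEdges, Finset.mem_biUnion]
  constructor
  · rintro ⟨y, hy, he⟩
    rwa [(frameCell_eq_iff hw e y).2 he]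
  · intro h
    exact ⟨_, h, mem_cellEdges_frameCell hw e⟩

include hw in
/-- A link lies in the box iff its frame cell is a box cell. -/
theorem mem_boxEdges_iff (e : ZdEdge 4) : e ∈ boxEdges w x₀ m ↔ frameCell w e ∈ boxCells x₀ m :=
  mem_regionEdges_iff hw _ e

include hw in
/-- The frame cell of a box link is a box cell. -/
theorem frameCell_mem_boxCells (v : BoxLink w x₀ m) : frameCell w v.1 ∈ boxCells x₀ m :=
  (mem_boxEdges_iff hw v.1).1 v.2

include hw in
/-- The label of a box link is the label of the box cell `y` iff the link lies in the cell `y`. -/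
theorem boxCell_eq_boxLabel_iff (v : BoxLink w x₀ m) {y : Fin 4 → ℤ} (hy : y ∈ boxCells x₀ m) :
    boxCell w x₀ m n v = boxLabel x₀ m n y ↔ frameCell w v.1 = y := by
  constructor
  · intro h
    exact boxLabel_injOn (Finset.mem_coe.2 (frameCell_mem_boxCells hw v)) (Finset.mem_coe.2 hy) h
  · intro h
    simp only [boxCell, h]

include hw in
/-- Two box links carry the same label iff they lie in the same frame cell. -/
theorem boxCell_eq_iff (v v' : BoxLink w x₀ m) :
    boxCell w x₀ m n v = boxCell w x₀ m n v' ↔ frameCell w v.1 = frameCell w v'.1 :=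
  boxCell_eq_boxLabel_iff hw v (frameCell_mem_boxCells hw v')

include hw in
/-- The cyclic distance of the labels of two box links is the `ℤ⁴` distance of their cells. -/
theorem cdist_boxCell (v v' : BoxLink w x₀ m) :
    cdist (boxCell w x₀ m n v) (boxCell w x₀ m n v') = cellDist (frameCell w v.1) (frameCell w v'.1) :=
  cdist_boxLabel (frameCell_mem_boxCells hw v) (frameCell_mem_boxCells hw v')

include hw in
/-- The cyclic distance from the label of a box cell to the label of a box link. -/
theorem cdist_boxLabel_boxCell {y : Fin 4 → ℤ} (hy : y ∈ boxCells x₀ m) (v : BoxLink w x₀ m) :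
    cdist (boxLabel x₀ m n y) (boxCell w x₀ m n v) = cellDist y (frameCell w v.1) :=
  cdist_boxLabel hy (frameCell_mem_boxCells hw v)

include hw in
/-- **A cell-union of box links is the link set of a set of box cells.**  For a link set `A ⊆ V` closed under
«same label», the set `Y` of frame cells met by `A` consists of box cells, `A` is exactly the set of box links with
frame cell in `Y`, and the image of `A` in `ℤ⁴` is `regionEdges w Y`. -/
theorem exists_cells_of_union (A : Finset (BoxLink w x₀ m))
    (hA : ∀ v v' : BoxLink w x₀ m, boxCell w x₀ m n v = boxCell w x₀ m n v' → v ∈ A → v' ∈ A) :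
    ∃ Y : Finset (Fin 4 → ℤ), Y ⊆ boxCells x₀ m ∧ (∀ v : BoxLink w x₀ m, v ∈ A ↔ frameCell w v.1 ∈ Y) ∧
      A.map (Function.Embedding.subtype fun e => e ∈ boxEdges w x₀ m) = regionEdges w Y := by
  classical
  refine ⟨A.image fun v => frameCell w v.1, ?_, ?_, ?_⟩
  · intro y hy
    obtain ⟨v, -, rfl⟩ := Finset.mem_image.1 hy
    exact frameCell_mem_boxCells hw v
  · intro v
    constructor
    · intro hv
      exact Finset.mem_image.2 ⟨v, hv, rfl⟩
    · intro hv
      obtain ⟨v', hv', hvv'⟩ := Finset.mem_image.1 hv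
      exact hA v' v ((boxCell_eq_iff hw v' v).2 hvv') hv'
  · ext e
    rw [mem_regionEdges_iff hw, Finset.mem_map, Finset.mem_image]
    constructor
    · rintro ⟨v, hv, rfl⟩
      exact ⟨v, hv, rfl⟩
    · rintro ⟨v, hv, hve⟩
      have he : e ∈ boxEdges w x₀ m := by
        rw [mem_boxEdges_iff hw, ← hve]
        exact frameCell_mem_boxCells hw v
      refine ⟨⟨e, he⟩, ?_, rfl⟩
      exact hA v ⟨e, he⟩ ((boxCell_eq_iff hw v ⟨e, he⟩).2 hve) hv

end Links

/-! ## §3 Padded configurations and the good family -/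

section Ext

variable {G : Type} {w : Fin 4 → ℤ → ℤ} {x₀ : Fin 4 → ℤ} {m n : ℕ}

/-- `boxExt` on a box link. -/
theorem boxExt_apply_mem (pad : LGConfig 4 G) (ζ : BoxLink w x₀ m → G) {e : ZdEdge 4} (he : e ∈ boxEdges w x₀ m) :
    boxExt w x₀ m pad ζ e = ζ ⟨e, he⟩ := by
  simp [boxExt, he]

/-- `boxExt` off the box is the padding. -/
theorem boxExt_apply_not_mem (pad : LGConfig 4 G) (ζ : BoxLink w x₀ m → G) {e : ZdEdge 4}
    (he : e ∉ boxEdges w x₀ m) : boxExt w x₀ m pad ζ e = pad e := by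
  simp [boxExt, he]

/-- `boxExt` on a box link (subtype form). -/
@[simp] theorem boxExt_apply_val (pad : LGConfig 4 G) (ζ : BoxLink w x₀ m → G) (v : BoxLink w x₀ m) :
    boxExt w x₀ m pad ζ v.1 = ζ v := by
  rw [boxExt_apply_mem pad ζ v.2]

/-- Restricting the padded extension gives back the box data. -/
@[simp] theorem boxRestrict_boxExt (pad : LGConfig 4 G) (ζ : BoxLink w x₀ m → G) :
    boxRestrict w x₀ m (boxExt w x₀ m pad ζ) = ζ := by
  funext v
  simp [boxRestrict]

/-- A configuration equal to the padding off the box is the padded extension of its restriction. -/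
theorem boxExt_boxRestrict (pad : LGConfig 4 G) {σ : LGConfig 4 G} (hσ : ∀ e ∉ boxEdges w x₀ m, σ e = pad e) :
    boxExt w x₀ m pad (boxRestrict w x₀ m σ) = σ := by
  funext e
  by_cases he : e ∈ boxEdges w x₀ m
  · rw [boxExt_apply_mem pad _ he]; rfl
  · rw [boxExt_apply_not_mem pad _ he, hσ e he]

/-- Two padded extensions agree off the box. -/
theorem boxExt_eq_of_not_mem (pad : LGConfig 4 G) (ζ ζ' : BoxLink w x₀ m → G) {e : ZdEdge 4}
    (he : e ∉ boxEdges w x₀ m) : boxExt w x₀ m pad ζ e = boxExt w x₀ m pad ζ' e := by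
  rw [boxExt_apply_not_mem pad ζ he, boxExt_apply_not_mem pad ζ' he]

/-- `boxExt` is measurable. -/
theorem measurable_boxExt [MeasurableSpace G] (pad : LGConfig 4 G) : Measurable (boxExt (G := G) w x₀ m pad) := by
  refine measurable_pi_lambda _ fun e => ?_
  by_cases he : e ∈ boxEdges w x₀ m
  · simp only [boxExt, he, dite_true]
    exact measurable_pi_apply _
  · simp only [boxExt, he, dite_false]
    exact measurable_const

/-- `boxRestrict` is measurable. -/
theorem measurable_boxRestrict [MeasurableSpace G] : Measurable (boxRestrict (G := G) w x₀ m) :=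
  measurable_pi_lambda _ fun _ => measurable_pi_apply _

variable (hw : ∀ i j, w i j + 1 ≤ w i (j + 1))

include hw in
/-- **Padded data off the box are the padding**: on a cell outside the box, typicality of `boxExt pad ζ` is
typicality of `pad` (a typical set reads its own cell only). -/
theorem boxExt_mem_iff_pad_mem {Typ : (Fin 4 → ℤ) → Set (LGConfig 4 G)}
    (hTd : ∀ c, DependsOn (fun σ : LGConfig 4 G => σ ∈ Typ c) ↑(cellEdges w c))
    (pad : LGConfig 4 G) (ζ : BoxLink w x₀ m → G) {y : Fin 4 → ℤ} (hy : y ∉ boxCells x₀ m) :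
    boxExt w x₀ m pad ζ ∈ Typ y ↔ pad ∈ Typ y := by
  have h : (boxExt w x₀ m pad ζ ∈ Typ y) = (pad ∈ Typ y) := by
    refine hTd y fun e he => boxExt_apply_not_mem pad ζ fun heb => hy ?_
    rw [← (frameCell_eq_iff hw e y).2 (Finset.mem_coe.1 he)]
    exact (mem_boxEdges_iff hw e).1 heb
  rw [h]

include hw in
/-- Typicality of two padded extensions on a cell agrees as soon as the box data agree on the links of that cell. -/
theorem boxExt_mem_iff_of_eqOn {Typ : (Fin 4 → ℤ) → Set (LGConfig 4 G)}
    (hTd : ∀ c, DependsOn (fun σ : LGConfig 4 G => σ ∈ Typ c) ↑(cellEdges w c))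
    (pad : LGConfig 4 G) {ζ ζ' : BoxLink w x₀ m → G} {y : Fin 4 → ℤ}
    (h : ∀ v : BoxLink w x₀ m, frameCell w v.1 = y → ζ v = ζ' v) :
    boxExt w x₀ m pad ζ ∈ Typ y ↔ boxExt w x₀ m pad ζ' ∈ Typ y := by
  have key : (boxExt w x₀ m pad ζ ∈ Typ y) = (boxExt w x₀ m pad ζ' ∈ Typ y) := by
    refine hTd y fun e he => ?_
    by_cases heb : e ∈ boxEdges w x₀ m
    · rw [boxExt_apply_mem pad ζ heb, boxExt_apply_mem pad ζ' heb]
      exact h ⟨e, heb⟩ ((frameCell_eq_iff hw e y).2 (Finset.mem_coe.1 he))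
    · exact boxExt_eq_of_not_mem pad ζ ζ' heb
  rw [key]

/-- **The good family at a box label**: good iff the padded data are typical on that cell. -/
theorem mem_boxGood_iff (pad : LGConfig 4 G) (Typ : (Fin 4 → ℤ) → Set (LGConfig 4 G)) {y : Fin 4 → ℤ}
    (hy : y ∈ boxCells x₀ m) (ζ : BoxLink w x₀ m → G) :
    ζ ∈ boxGood w x₀ m n pad Typ (boxLabel x₀ m n y) ↔ boxExt w x₀ m pad ζ ∈ Typ y := by
  constructor
  · intro h
    exact h y hy rfl
  · intro h y' hy' hyy'
    rw [boxLabel_injOn (Finset.mem_coe.2 hy') (Finset.mem_coe.2 hy) hyy']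
    exact h

/-- **The good family at a phantom label** (carried by no box cell) is everything. -/
theorem mem_boxGood_of_phantom (pad : LGConfig 4 G) (Typ : (Fin 4 → ℤ) → Set (LGConfig 4 G))
    {c : CoarseIdx (boxMod m n)} (hc : ∀ y ∈ boxCells x₀ m, boxLabel x₀ m n y ≠ c) (ζ : BoxLink w x₀ m → G) :
    ζ ∈ boxGood w x₀ m n pad Typ c :=
  fun y hy hyc => absurd hyc (hc y hy)

/-- The good family consists of measurable sets. -/
theorem measurableSet_boxGood [MeasurableSpace G] (pad : LGConfig 4 G) {Typ : (Fin 4 → ℤ) → Set (LGConfig 4 G)}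
    (hTm : ∀ c, MeasurableSet (Typ c)) (c : CoarseIdx (boxMod m n)) :
    MeasurableSet (boxGood w x₀ m n pad Typ c) := by
  have h : boxGood w x₀ m n pad Typ c =
      ⋂ y ∈ (boxCells x₀ m).filter (fun y => boxLabel x₀ m n y = c), boxExt w x₀ m pad ⁻¹' Typ y := by
    ext ζ
    simp only [boxGood, Set.mem_setOf_eq, Set.mem_iInter, Finset.mem_filter, Set.mem_preimage, and_imp]
  rw [h]
  exact Finset.measurableSet_biInter _ fun y _ => measurable_boxExt pad (hTm y)

include hw in
/-- The good family is cell-local (the engine's `good_local`). -/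
theorem boxGood_local {Typ : (Fin 4 → ℤ) → Set (LGConfig 4 G)}
    (hTd : ∀ c, DependsOn (fun σ : LGConfig 4 G => σ ∈ Typ c) ↑(cellEdges w c)) (pad : LGConfig 4 G)
    (c : CoarseIdx (boxMod m n)) (ζ ζ' : BoxLink w x₀ m → G)
    (h : ∀ v : BoxLink w x₀ m, boxCell w x₀ m n v = c → ζ v = ζ' v) :
    ζ ∈ boxGood w x₀ m n pad Typ c ↔ ζ' ∈ boxGood w x₀ m n pad Typ c := by
  simp only [boxGood, Set.mem_setOf_eq]
  refine forall₂_congr fun y hy => forall_congr' fun hyc => ?_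
  refine boxExt_mem_iff_of_eqOn hw hTd pad fun v hv => h v ?_
  rw [← hyc]
  exact (boxCell_eq_boxLabel_iff hw v hy).2 hv

end Ext

/-! ## §4 The box kernels -/

section Spec

variable {G : Type} [Group G] [TopologicalSpace G] [IsTopologicalGroup G] [CompactSpace G]
  [MeasurableSpace G] [BorelSpace G]
variable {N : ℕ} (ρ : G →* Matrix (Fin N) (Fin N) ℂ) (β : ℝ) (w : Fin 4 → ℤ → ℤ) (x₀ : Fin 4 → ℤ) (m : ℕ)
  (pad : LGConfig 4 G)

/-- The box kernel on a measurable set is the `ℤ⁴` kernel of the padded exterior on the pulled-back set. -/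
theorem boxSpec_apply (A : Finset (BoxLink w x₀ m)) (ζ : BoxLink w x₀ m → G) {E : Set (BoxLink w x₀ m → G)}
    (hE : MeasurableSet E) :
    boxSpec ρ β w x₀ m pad A ζ E =
      ymSpecification ρ β (A.map (Function.Embedding.subtype fun e => e ∈ boxEdges w x₀ m)) (boxExt w x₀ m pad ζ)
        (boxRestrict w x₀ m ⁻¹' E) := by
  simp only [boxSpec]
  rw [Measure.map_apply measurable_boxRestrict hE]

/-- **Integrals against the box kernel** are `ℤ⁴`-kernel integrals of the observable read through `boxRestrict`. -/
theorem integral_boxSpec (A : Finset (BoxLink w x₀ m)) (ζ : BoxLink w x₀ m → G) {f : (BoxLink w x₀ m → G) → ℝ}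
    (hf : Measurable f) :
    ∫ σ, f σ ∂(boxSpec ρ β w x₀ m pad A ζ) =
      ∫ U, f (boxRestrict w x₀ m U) ∂(ymSpecification ρ β
        (A.map (Function.Embedding.subtype fun e => e ∈ boxEdges w x₀ m)) (boxExt w x₀ m pad ζ)) := by
  simp only [boxSpec]
  rw [integral_map measurable_boxRestrict.aemeasurable hf.aestronglyMeasurable]

/-- The box kernels are probability measures. -/
theorem isProbabilityMeasure_boxSpec [SecondCountableTopology G] (hρ : Continuous ρ) (A : Finset (BoxLink w x₀ m)) (ζ : BoxLink w x₀ m → G) :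
    IsProbabilityMeasure (boxSpec ρ β w x₀ m pad A ζ) := by
  simp only [boxSpec]
  haveI := isProbabilityMeasure_ymSpecification (d := 4) ρ hρ β
    (A.map (Function.Embedding.subtype fun e => e ∈ boxEdges w x₀ m)) (boxExt w x₀ m pad ζ)
  exact Measure.isProbabilityMeasure_map measurable_boxRestrict.aemeasurable

end Spec

end Summit.QuantumFields.YangMills.Cruxes.IR.AfPincerUc.Port

end
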